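import Literature.AlgebraicGeometry.Frobenioids.EquivalenceUnitsTransport
import Literature.AlgebraicGeometry.Frobenioids.BaseFrobeniusSections
import HarnessLib

/-!
# Frobenioids I: the image of a base-section under an equivalence lying over the base
# (tools for [FrdI] Cor. 5.7 (i), "Ψ maps base-sections of C₁ to base-sections of C₂")

Mochizuki, *The geometry of Frobenioids I: the general theory*, Kyushu J. Math. **62** (2008)
293–400, kurims text Def. 2.7 (i) p. 51, Cor. 5.7 (i) p. 108 [cite: MochizukiFrdI2008, Cor. 5.7 (i) p.108].

PROOF-ONLY file (no new definitions). For a base-section `P₁ ⊆ C₁` (Def. 2.7 (i): a subcategory of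
pull-back morphisms which is a skeleton, whose objects are Frobenius-trivial and such that `P₁ ⥲ D₁`) and
an equivalence `Ψ : C₁ ⥲ C₂` lying over an equivalence `Ψ^Base : D₁ ⥲ D₂` (the square
`η : Base₂ ∘ Ψ ≅ Ψ^Base ∘ Base₁` of [FrdI] Cor. 4.11 (ii)) which preserves pull-back morphisms and
morphisms of Frobenius type and acts on Frobenius degrees through an automorphism `Ψ^{N_{≥1}}`
([FrdI] Thm. 3.4 (iii)), we prove:

* objects of a base-section isomorphic in `C₁` are EQUAL (`IsBaseSection.eq_of_iso`) — so `Ψ` is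
  injective on the objects of `P₁` and the image `Ψ(P₁) = {Ψ A}, {Ψ f}` is a genuine subcategory;
* any presection `P₂` of `C₂` with exactly these objects and arrows (hypotheses `hobj`, `hhom`) is a
  base-section of `C₂` (`image_isBaseSection`: pull-back arrows, skeleton, Frobenius-trivial objects,
  `P₂ ⥲ D₂` through `P₁ ⥲ D₁ ⥲ D₂`);
* transporting a family of endomorphisms `c_A ∈ End(A)`, `A ∈ Ob(P₁)`, into `End(Ψ A)` does not depend
  on the chosen preimage (`image_component_eq`, `image_component_eq'`).

The presection `P₂` itself is built by its user (`BaseSectionsOfObjectsCor57Proofs.lean`). Nothing here is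
specific to the abc programme; no statement of the paper is strengthened.
-/

namespace Literature.AlgebraicGeometry.Frobenioids

open CategoryTheory Opposite

universe w v v' u u'

namespace PreFrobenioid

/-! ### Objects of a base-section are determined up to equality by their isomorphism class -/

section OneFrobenioid

variable {D : Type u} [Category.{v} D] {Φ : Dᵒᵖ ⥤ CommMonCat.{w}}
  {C : Type u'} [Category.{v'} C] (F : C ⥤ ElemFrobenioid Φ)

/-- Two objects of a base-section `P` that are isomorphic in `C` are EQUAL: the isomorphism maps to
an isomorphism of `D`, which lifts to `P` along the equivalence `P ⥲ D` (Def. 2.7 (i) (c)), and `P`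
is a skeleton (Def. 2.7 (i) (a)). [cite: MochizukiFrdI2008, Def. 2.7 (i) p.51] -/
theorem IsBaseSection.eq_of_iso {P : Presection C} (hP : IsBaseSection F P) {A A' : C}
    (hA : P.obj A) (hA' : P.obj A') (e : A ≅ A') : A = A' := by
  haveI := hP.isEquivalence
  let X : P.Cat := ⟨A, hA⟩
  let X' : P.Cat := ⟨A', hA'⟩
  have eD : (P.toBase F).obj X ≅ (P.toBase F).obj X' := (baseFunctor F).mapIso e
  have h := hP.isSkeleton X X' ⟨(P.toBase F).preimageIso eD⟩
  exact congrArg Subtype.val h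

end OneFrobenioid

/-! ### The image of a base-section under an equivalence `Ψ` lying over `Ψ^Base` -/

section TwoFrobenioids

variable {D₁ : Type u} [Category.{v} D₁] {Φ₁ : D₁ᵒᵖ ⥤ CommMonCat.{w}}
  {C₁ : Type u'} [Category.{v'} C₁] (F₁ : C₁ ⥤ ElemFrobenioid Φ₁)
  {D₂ : Type u} [Category.{v} D₂] {Φ₂ : D₂ᵒᵖ ⥤ CommMonCat.{w}}
  {C₂ : Type u'} [Category.{v'} C₂] (F₂ : C₂ ⥤ ElemFrobenioid Φ₂)

variable (Ψ : C₁ ≌ C₂) {P₁ : Presection C₁} {P₂ : Presection C₂}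

/-- In the image presection, arrows in `P₂` are pull-back morphisms (Def. 2.7 (i): `P ⊆ C^pl-bk`), since
`Ψ` preserves pull-back morphisms (Thm. 3.4 (iii)). [cite: MochizukiFrdI2008, Cor. 5.7 (i) p.108] -/
theorem image_hom_pullback (hP : IsBaseSection F₁ P₁)
    (hpb : PreFrobenioidData.PreservesMor Ψ.functor (PreFrobenioidData.ofFunctor Φ₁ F₁).IsPullbackMorphism
      (PreFrobenioidData.ofFunctor Φ₂ F₂).IsPullbackMorphism)
    (hhom : ∀ ⦃B B' : C₂⦄ (g : B ⟶ B'), P₂.hom g ↔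
      ∃ (A A' : C₁) (f : A ⟶ A') (hA : Ψ.functor.obj A = B) (hA' : Ψ.functor.obj A' = B'),
        P₁.hom f ∧ g = eqToHom hA.symm ≫ Ψ.functor.map f ≫ eqToHom hA')
    {B B' : C₂} (g : B ⟶ B') (hg : P₂.hom g) : IsPullbackMorphism F₂ g := by
  obtain ⟨A, A', f, rfl, rfl, hf, rfl⟩ := (hhom g).mp hg
  simp only [eqToHom_refl, Category.id_comp, Category.comp_id]
  exact (PreFrobenioidData.ofFunctor_isPullbackMorphism F₂ _).mp
    (hpb _ ((PreFrobenioidData.ofFunctor_isPullbackMorphism F₁ f).mpr (hP.hom_pullback f hf)))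

/-- The image presection is a skeleton: isomorphic images `Ψ(A) ≅ Ψ(A')` give `A ≅ A'`, hence `A = A'`.
[cite: MochizukiFrdI2008, Cor. 5.7 (i) p.108] -/
theorem image_isSkeleton (hP : IsBaseSection F₁ P₁)
    (hobj : ∀ B : C₂, P₂.obj B ↔ ∃ A : C₁, P₁.obj A ∧ Ψ.functor.obj A = B) : P₂.IsSkeleton := by
  rintro ⟨B, hB⟩ ⟨B', hB'⟩ ⟨e⟩
  obtain ⟨A, hA, rfl⟩ := (hobj B).mp hB
  obtain ⟨A', hA', rfl⟩ := (hobj B').mp hB'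
  have e' : Ψ.functor.obj A ≅ Ψ.functor.obj A' := P₂.ι.mapIso e
  have hAA' := hP.eq_of_iso F₁ hA hA' (Ψ.functor.preimageIso e')
  subst hAA'
  rfl

/-- The image presection is equivalent to `D₂` via `Base₂`: faithful, full and essentially surjective,
from `P₁ ⥲ D₁` (Def. 2.7 (i) (c)), the equivalence `Ψ^Base : D₁ ⥲ D₂` and the square `η`.
[cite: MochizukiFrdI2008, Cor. 5.7 (i) p.108] -/
theorem image_toBase_isEquivalence (hP : IsBaseSection F₁ P₁) (ΨBase : D₁ ⥤ D₂) [ΨBase.IsEquivalence]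
    (η : Ψ.functor ⋙ baseFunctor F₂ ≅ baseFunctor F₁ ⋙ ΨBase)
    (hobj : ∀ B : C₂, P₂.obj B ↔ ∃ A : C₁, P₁.obj A ∧ Ψ.functor.obj A = B)
    (hhom : ∀ ⦃B B' : C₂⦄ (g : B ⟶ B'), P₂.hom g ↔
      ∃ (A A' : C₁) (f : A ⟶ A') (hA : Ψ.functor.obj A = B) (hA' : Ψ.functor.obj A' = B'),
        P₁.hom f ∧ g = eqToHom hA.symm ≫ Ψ.functor.map f ≫ eqToHom hA') :
    (P₂.toBase F₂).IsEquivalence := by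
  haveI := hP.isEquivalence
  refine { faithful := ⟨fun {X Y} g g' h => ?_⟩, full := ⟨fun {X Y} d => ?_⟩, essSurj := ⟨fun Y => ?_⟩ }
  · -- faithful
    obtain ⟨B, hB⟩ := X
    obtain ⟨B', hB'⟩ := Y
    obtain ⟨A, hA, rfl⟩ := (hobj B).mp hB
    obtain ⟨A', hA', rfl⟩ := (hobj B').mp hB'
    apply Presection.hom_ext
    obtain ⟨A₀, A₀', f, hA₀, hA₀', hf, hg⟩ := (hhom g.1).mp g.2
    obtain ⟨A₁, A₁', f', hA₁, hA₁', hf', hg'⟩ := (hhom g'.1).mp g'.2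
    obtain rfl : A = A₀ :=
      hP.eq_of_iso F₁ hA (P₁.obj_of_hom f hf).1 (Ψ.functor.preimageIso (eqToIso hA₀)).symm
    obtain rfl : A' = A₀' :=
      hP.eq_of_iso F₁ hA' (P₁.obj_of_hom f hf).2 (Ψ.functor.preimageIso (eqToIso hA₀')).symm
    obtain rfl : A = A₁ :=
      hP.eq_of_iso F₁ hA (P₁.obj_of_hom f' hf').1 (Ψ.functor.preimageIso (eqToIso hA₁)).symm
    obtain rfl : A' = A₁' :=
      hP.eq_of_iso F₁ hA' (P₁.obj_of_hom f' hf').2 (Ψ.functor.preimageIso (eqToIso hA₁')).symm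
    simp only [eqToHom_refl, Category.id_comp, Category.comp_id] at hg hg'
    -- `Base₂ (Ψ f) = Base₂ (Ψ f')` forces `Base₁ f = Base₁ f'`, hence `f = f'` by faithfulness of `P₁ → D₁`
    have h' : (baseFunctor F₂).map g.1 = (baseFunctor F₂).map g'.1 := h
    rw [hg, hg'] at h'
    have hb : (Ψ.functor ⋙ baseFunctor F₂).map f = (Ψ.functor ⋙ baseFunctor F₂).map f' := h'
    rw [comp_base_map_eq_conj F₁ F₂ Ψ ΨBase η f, comp_base_map_eq_conj F₁ F₂ Ψ ΨBase η f',
      NatIso.cancel_natIso_hom_left, NatIso.cancel_natIso_inv_right] at hb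
    have hb' : (baseFunctor F₁).map f = (baseFunctor F₁).map f' := ΨBase.map_injective hb
    let X₁ : P₁.Cat := ⟨A, hA⟩
    let X₁' : P₁.Cat := ⟨A', hA'⟩
    let φ : X₁ ⟶ X₁' := ⟨f, hf⟩
    let φ' : X₁ ⟶ X₁' := ⟨f', hf'⟩
    have hφ : φ = φ' := (P₁.toBase F₁).map_injective hb'
    rw [hg, hg']
    exact congrArg (fun ψ : X₁ ⟶ X₁' => Ψ.functor.map ψ.1) hφ
  · -- full
    obtain ⟨B, hB⟩ := X
    obtain ⟨B', hB'⟩ := Y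
    obtain ⟨A, hA, rfl⟩ := (hobj B).mp hB
    obtain ⟨A', hA', rfl⟩ := (hobj B').mp hB'
    -- view `d` as an arrow `(Ψ ⋙ Base₂)(A) ⟶ (Ψ ⋙ Base₂)(A')`
    obtain ⟨d, rfl⟩ : ∃ d' : (Ψ.functor ⋙ baseFunctor F₂).obj A ⟶ (Ψ.functor ⋙ baseFunctor F₂).obj A',
        d' = d := ⟨d, rfl⟩
    let X₁ : P₁.Cat := ⟨A, hA⟩
    let X₁' : P₁.Cat := ⟨A', hA'⟩
    -- conjugate into `Ψ^Base (Base₁ A) ⟶ Ψ^Base (Base₁ A')` and lift twice (Ψ^Base full, `P₁ → D₁` full)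
    obtain ⟨d₁, hd₁⟩ : ∃ d₁ : (P₁.toBase F₁).obj X₁ ⟶ (P₁.toBase F₁).obj X₁',
        ΨBase.map d₁ = η.inv.app A ≫ d ≫ η.hom.app A' := ⟨_, ΨBase.map_preimage _⟩
    obtain ⟨f₁, hf₁⟩ : ∃ f₁ : X₁ ⟶ X₁', (P₁.toBase F₁).map f₁ = d₁ :=
      ⟨_, (P₁.toBase F₁).map_preimage d₁⟩
    refine ⟨⟨Ψ.functor.map f₁.1, (hhom _).mpr ⟨A, A', f₁.1, rfl, rfl, f₁.2, by simp⟩⟩, ?_⟩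
    show (Ψ.functor ⋙ baseFunctor F₂).map f₁.1 = d
    have h1 : (baseFunctor F₁ ⋙ ΨBase).map f₁.1 = η.inv.app A ≫ d ≫ η.hom.app A' := by
      show ΨBase.map ((P₁.toBase F₁).map f₁) = _
      rw [hf₁, hd₁]
    rw [comp_base_map_eq_conj F₁ F₂ Ψ ΨBase η (A := A) (A' := A') f₁.1, h1]
    simp only [Category.assoc, Iso.hom_inv_id_app_assoc, Iso.hom_inv_id_app, Category.comp_id]
  · -- essentially surjective
    let X₁ : D₁ := ΨBase.objPreimage Y
    let X₀ : P₁.Cat := (P₁.toBase F₁).objPreimage X₁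
    refine ⟨⟨Ψ.functor.obj X₀.1, (hobj _).mpr ⟨X₀.1, X₀.2, rfl⟩⟩, ⟨?_⟩⟩
    exact (η.app X₀.1).trans ((ΨBase.mapIso ((P₁.toBase F₁).objObjPreimageIso X₁)).trans
      (ΨBase.objObjPreimageIso Y))

/-- The image presection of a base-section `P₁` under `Ψ` is a base-section of `C₂`, given that `Ψ`
preserves pull-back morphisms and morphisms of Frobenius type, acts on Frobenius degrees through
`Ψ^{N_{≥1}}` (Thm. 3.4 (iii)) and lies over an equivalence `Ψ^Base` (Cor. 4.11 (ii)).
[cite: MochizukiFrdI2008, Cor. 5.7 (i) p.108] -/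
theorem image_isBaseSection (hP : IsBaseSection F₁ P₁) (ΨBase : D₁ ⥤ D₂) [ΨBase.IsEquivalence]
    (η : Ψ.functor ⋙ baseFunctor F₂ ≅ baseFunctor F₁ ⋙ ΨBase)
    (hpb : PreFrobenioidData.PreservesMor Ψ.functor (PreFrobenioidData.ofFunctor Φ₁ F₁).IsPullbackMorphism
      (PreFrobenioidData.ofFunctor Φ₂ F₂).IsPullbackMorphism)
    (hft : PreFrobenioidData.PreservesMor Ψ.functor (PreFrobenioidData.ofFunctor Φ₁ F₁).IsFrobeniusType
      (PreFrobenioidData.ofFunctor Φ₂ F₂).IsFrobeniusType)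
    (ΨN : ℕ+ ≃* ℕ+) (hN : ∀ ⦃A B : C₁⦄ (φ : A ⟶ B), degFr F₂ (Ψ.functor.map φ) = ΨN (degFr F₁ φ))
    (hobj : ∀ B : C₂, P₂.obj B ↔ ∃ A : C₁, P₁.obj A ∧ Ψ.functor.obj A = B)
    (hhom : ∀ ⦃B B' : C₂⦄ (g : B ⟶ B'), P₂.hom g ↔
      ∃ (A A' : C₁) (f : A ⟶ A') (hA : Ψ.functor.obj A = B) (hA' : Ψ.functor.obj A' = B'),
        P₁.hom f ∧ g = eqToHom hA.symm ≫ Ψ.functor.map f ≫ eqToHom hA') :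
    IsBaseSection F₂ P₂ := by
  refine ⟨fun g hg => image_hom_pullback F₁ F₂ Ψ hP hpb hhom g hg, image_isSkeleton F₁ Ψ hP hobj,
    fun B hB => ?_, image_toBase_isEquivalence F₁ F₂ Ψ hP ΨBase η hobj hhom⟩
  obtain ⟨A, hA, rfl⟩ := (hobj B).mp hB
  exact isFrobeniusTrivial_map_of_square F₁ F₂ Ψ ΨBase η hft ΨN hN (hP.isFrobeniusTrivial A hA)

/-- Transporting a family of endomorphisms `c_A ∈ End(A)`, `A ∈ Ob(P₁)` (e.g. the components of an
element of `End(P₁ ↪ C₁)`) along `Ψ` does not depend on the chosen preimage: if `Ψ(A₀) = B = Ψ(A)` with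
`A₀, A ∈ Ob(P₁)` then `A₀ = A` (base-sections are skeleta equivalent to the base), so the two conjugates
of `Ψ(c_{A₀})`, `Ψ(c_A)` into `End(B)` agree. [cite: MochizukiFrdI2008, Cor. 5.7 (i) p.108] -/
theorem image_component_eq (hP : IsBaseSection F₁ P₁) (c : ∀ A : C₁, P₁.obj A → (A ⟶ A)) {A A₀ : C₁}
    {B : C₂} (hA : P₁.obj A) (hA₀ : P₁.obj A₀) (h : Ψ.functor.obj A = B) (h₀ : Ψ.functor.obj A₀ = B) :
    eqToHom h₀.symm ≫ Ψ.functor.map (c A₀ hA₀) ≫ eqToHom h₀ =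
      eqToHom h.symm ≫ Ψ.functor.map (c A hA) ≫ eqToHom h := by
  subst h
  obtain rfl : A = A₀ := hP.eq_of_iso F₁ hA hA₀ (Ψ.functor.preimageIso (eqToIso h₀)).symm
  rfl

/-- The same, at a presented object `B = Ψ(A)`: the conjugate of `Ψ(c_{A₀})` IS `Ψ(c_A)`.
[cite: MochizukiFrdI2008, Cor. 5.7 (i) p.108] -/
theorem image_component_eq' (hP : IsBaseSection F₁ P₁) (c : ∀ A : C₁, P₁.obj A → (A ⟶ A)) {A A₀ : C₁}
    (hA : P₁.obj A) (hA₀ : P₁.obj A₀) (h₀ : Ψ.functor.obj A₀ = Ψ.functor.obj A) :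
    eqToHom h₀.symm ≫ Ψ.functor.map (c A₀ hA₀) ≫ eqToHom h₀ = Ψ.functor.map (c A hA) := by
  obtain rfl : A = A₀ := hP.eq_of_iso F₁ hA hA₀ (Ψ.functor.preimageIso (eqToIso h₀)).symm
  simp

end TwoFrobenioids

end PreFrobenioid

end Literature.AlgebraicGeometry.Frobenioids
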